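import Mathlib

/-!
# The semigroups `𝒫𝒯ₙ` and `ℐ𝒮ₙ` of partial transformations: cardinalities and idempotents

Results of [Ganyushkin–Mazorchuk 2009, §1.1, §2.1, §2.3, §2.5, §2.7] on the semigroup `𝒫𝒯(X)`
of all partial transformations of a (finite) set `X` and its subsemigroup `ℐ𝒮(X)` of partial
injections (the symmetric inverse semigroup).

Encoding (no new definitions are introduced): a partial transformation `α` of `X` is a
function `α : X → Option X`, `α x = none` meaning "`α` is not defined at `x`"; thus
`dom α = {x | (α x).isSome}`, `im α = {y | ∃ x, α x = some y}`, and the product of the book,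
`(αβ)(x) = α(β(x))` (defined iff both steps are), is `fun x => (β x).bind α`.  `α` is a partial
injection iff `α x₁ = α x₂ = some y` forces `x₁ = x₂`.

* Proposition 1.1.2: `|𝒯ₙ| = nⁿ`, `|𝒫𝒯ₙ| = (n + 1)ⁿ` (`card_transformation`, `card_partial`);
* Proposition 2.1.1: the product is associative (`mul_assoc`); Proposition 2.3.2: the nowhere
  defined transformation `𝟎` is a zero (`zero_mul`, `mul_zero`); §2.5: partial injections are
  closed under the product (`injective_mul`);
* Theorem 2.5.1: `|ℐ𝒮ₙ| = ∑_{k=0}^{n} (n choose k)² k!` (`card_partialInjection`), via the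
  count `n! / (n - k)! = (n choose k) k!` of the partial injections with a given `k`-element
  domain (`card_partialInjection_dom_eq`);
* Theorem 2.7.2: `α ∈ 𝒫𝒯ₙ` is an idempotent iff `im α ⊆ dom α` and `α` restricted to `im α` is
  the identity (`idempotent_iff`);
* Corollary 2.7.3: the idempotents of `ℐ𝒮ₙ` are exactly the partial identities `ε_A`; there are
  `2ⁿ` of them (`idempotent_iff_of_injective`, `card_injective_idempotents`);
  Exercise 2.7.7: `ε_A ε_B = ε_{A ∩ B}` (`partialId_mul_partialId`);
* Corollary 2.7.5: `|E(𝒫𝒯ₙ)| = ∑_{k=0}^{n} (n choose k) (k + 1)^{n-k}` (`card_idempotents`), via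
  the count `(k + 1)^{n-k}` of idempotents with a given `k`-element image
  (`card_idempotents_image_eq`).

## References
* [GanyushkinMazorchuk2009] O. Ganyushkin, V. Mazorchuk, *Classical Finite Transformation
  Semigroups. An Introduction*, Algebra and Applications 9, Springer, 2009, Chapters 1–2.
-/

namespace Literature.Algebra.Semigroups.PartialTransformation

open Function Set
open scoped Nat

variable {X : Type*}

/-! ### Proposition 1.1.2: cardinalities of `𝒯ₙ` and `𝒫𝒯ₙ` -/

/-- Proposition 1.1.2: `|𝒯ₙ| = nⁿ`. [cite: GanyushkinMazorchuk2009, Proposition 1.1.2] -/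
theorem card_transformation [Fintype X] [DecidableEq X] :
    Fintype.card (X → X) = Fintype.card X ^ Fintype.card X :=
  Fintype.card_fun

/-- Proposition 1.1.2: `|𝒫𝒯ₙ| = (n + 1)ⁿ` — the image of each point is chosen independently in
`X ∪ {∅}`. [cite: GanyushkinMazorchuk2009, Proposition 1.1.2] -/
theorem card_partial [Fintype X] [DecidableEq X] :
    Fintype.card (X → Option X) = (Fintype.card X + 1) ^ Fintype.card X := by
  rw [Fintype.card_fun, Fintype.card_option]

/-! ### Propositions 2.1.1, 2.3.2, §2.5: the semigroup structure -/

/-- Proposition 2.1.1: the product of partial transformations, `(αβ)(x) = α(β(x))`, is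
associative: `γ(βα) = (γβ)α`. [cite: GanyushkinMazorchuk2009, Proposition 2.1.1] -/
theorem mul_assoc (α β γ : X → Option X) :
    (fun x => ((fun y => (α y).bind β) x).bind γ) = fun x => (α x).bind fun y => (β y).bind γ := by
  funext x
  exact Option.bind_assoc (α x) β γ

/-- Proposition 2.3.2: the nowhere defined partial transformation `𝟎` is a left zero of `𝒫𝒯(X)`:
`𝟎α = 𝟎`. [cite: GanyushkinMazorchuk2009, Proposition 2.3.2] -/
theorem zero_mul (α : X → Option X) :
    (fun x => (α x).bind (fun _ => (none : Option X))) = fun _ => none := by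
  funext x
  exact Option.bind_fun_none (α x)

/-- Proposition 2.3.2: `𝟎` is a right zero of `𝒫𝒯(X)`: `α𝟎 = 𝟎`.
[cite: GanyushkinMazorchuk2009, Proposition 2.3.2] -/
theorem mul_zero (α : X → Option X) :
    (fun _ : X => (none : Option X).bind α) = fun _ => none :=
  rfl

/-- §2.5: the product of two partial injections is a partial injection.
[cite: GanyushkinMazorchuk2009, §2.5] -/
theorem injective_mul {α β : X → Option X}
    (hα : ∀ x₁ x₂ y, α x₁ = some y → α x₂ = some y → x₁ = x₂)
    (hβ : ∀ x₁ x₂ y, β x₁ = some y → β x₂ = some y → x₁ = x₂) :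
    ∀ x₁ x₂ y, (β x₁).bind α = some y → (β x₂).bind α = some y → x₁ = x₂ := by
  intro x₁ x₂ y h1 h2
  obtain ⟨z₁, hz₁, hαz₁⟩ := Option.bind_eq_some_iff.1 h1
  obtain ⟨z₂, hz₂, hαz₂⟩ := Option.bind_eq_some_iff.1 h2
  obtain rfl := hα z₁ z₂ y hαz₁ hαz₂
  exact hβ x₁ x₂ z₁ hz₁ hz₂

/-! ### Theorem 2.5.1: `|ℐ𝒮ₙ|` -/

/-- The partial injections with a prescribed domain `A` correspond to the injective maps
`A ↪ X`, so there are `n (n-1) ⋯ (n - |A| + 1) = (n choose |A|) · |A|!` of them (the choice of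
the image and of a bijection onto it). [cite: GanyushkinMazorchuk2009, Theorem 2.5.1 (proof)] -/
theorem card_partialInjection_dom_eq [Fintype X] [DecidableEq X] (A : Finset X) :
    Fintype.card {α : X → Option X // (∀ x₁ x₂ y, α x₁ = some y → α x₂ = some y → x₁ = x₂) ∧
      Finset.univ.filter (fun x => (α x).isSome) = A} =
      (Fintype.card X).choose A.card * (A.card)! := by
  have hdom : ∀ α : X → Option X, Finset.univ.filter (fun x => (α x).isSome) = A ↔
      ∀ x, (α x).isSome ↔ x ∈ A := by
    intro α
    rw [Finset.ext_iff]
    simp only [Finset.mem_filter, Finset.mem_univ, true_and]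
  let e : {α : X → Option X // (∀ x₁ x₂ y, α x₁ = some y → α x₂ = some y → x₁ = x₂) ∧
      Finset.univ.filter (fun x => (α x).isSome) = A} ≃ (↥A ↪ X) :=
    { toFun := fun α => ⟨fun a => (α.1 a.1).get (((hdom α.1).1 α.2.2 a.1).2 a.2), by
        intro a b hab
        apply Subtype.ext
        refine α.2.1 a.1 b.1 ((α.1 a.1).get (((hdom α.1).1 α.2.2 a.1).2 a.2)) ?_ ?_
        · exact (Option.some_get _).symm
        · simp only at hab
          rw [hab]
          exact (Option.some_get _).symm⟩
      invFun := fun f => ⟨fun x => if hx : x ∈ A then some (f ⟨x, hx⟩) else none, by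
        refine ⟨fun x₁ x₂ y h1 h2 => ?_, (hdom _).2 fun x => ?_⟩
        · dsimp only at h1 h2
          by_cases hx₁ : x₁ ∈ A
          · by_cases hx₂ : x₂ ∈ A
            · rw [dif_pos hx₁] at h1
              rw [dif_pos hx₂] at h2
              have := f.injective ((Option.some_inj.1 h1).trans (Option.some_inj.1 h2).symm)
              exact congrArg Subtype.val this
            · rw [dif_neg hx₂] at h2
              exact absurd h2 (by simp)
          · rw [dif_neg hx₁] at h1
            exact absurd h1 (by simp)
        · by_cases hx : x ∈ A
          · simp [hx]
          · simp [hx]⟩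
      left_inv := by
        rintro ⟨α, hinj, hA⟩
        apply Subtype.ext
        funext x
        simp only
        by_cases hx : x ∈ A
        · rw [dif_pos hx]
          exact Option.some_get _
        · rw [dif_neg hx]
          have : ¬ ((α x).isSome) := fun h => hx (((hdom α).1 hA x).1 h)
          rw [Option.not_isSome_iff_eq_none] at this
          exact this.symm
      right_inv := by
        intro f
        ext a
        simp }
  rw [Fintype.card_congr e, Fintype.card_embedding_eq, Fintype.card_coe,
    Nat.descFactorial_eq_factorial_mul_choose, mul_comm]

/-- Theorem 2.5.1: `|ℐ𝒮ₙ| = ∑_{k=0}^{n} (n choose k)² · k!` — choose the domain, the image, and a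
bijection between them. [cite: GanyushkinMazorchuk2009, Theorem 2.5.1] -/
theorem card_partialInjection [Fintype X] [DecidableEq X] :
    Fintype.card {α : X → Option X // ∀ x₁ x₂ y, α x₁ = some y → α x₂ = some y → x₁ = x₂} =
      ∑ k ∈ Finset.range (Fintype.card X + 1),
        (Fintype.card X).choose k ^ 2 * k ! := by
  -- sort the partial injections by their domain
  have h1 : Fintype.card {α : X → Option X //
      ∀ x₁ x₂ y, α x₁ = some y → α x₂ = some y → x₁ = x₂} =
      ∑ A : Finset X, Fintype.card {α : X → Option X //
        (∀ x₁ x₂ y, α x₁ = some y → α x₂ = some y → x₁ = x₂) ∧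
        Finset.univ.filter (fun x => (α x).isSome) = A} := by
    rw [Fintype.card_subtype]
    rw [Finset.card_eq_sum_card_fiberwise
      (f := fun α : X → Option X => Finset.univ.filter (fun x => (α x).isSome))
      (t := Finset.univ) (fun _ _ => Finset.mem_coe.2 (Finset.mem_univ _))]
    refine Finset.sum_congr rfl fun A _ => ?_
    rw [Fintype.card_subtype, Finset.filter_filter]
  rw [h1]
  simp_rw [card_partialInjection_dom_eq]
  have h2 := Finset.sum_powerset_apply_card
    (fun k => (Fintype.card X).choose k * k !) (x := (Finset.univ : Finset X))
  simp only [Finset.powerset_univ, Finset.card_univ, smul_eq_mul] at h2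
  rw [h2]
  refine Finset.sum_congr rfl fun k _ => ?_
  ring

/-! ### Theorem 2.7.2: idempotents of `𝒫𝒯ₙ` -/

/-- Theorem 2.7.2: a partial transformation `α` is an idempotent (`α² = α`) iff `im α ⊆ dom α`
and the restriction of `α` to `im α` is the identity — i.e. iff `α y = y` (defined) for every
`y = α x ∈ im α`. [cite: GanyushkinMazorchuk2009, Theorem 2.7.2] -/
theorem idempotent_iff (α : X → Option X) :
    (fun x => (α x).bind α) = α ↔ ∀ x y, α x = some y → α y = some y := by
  constructor
  · intro h x y hxy
    have := congrFun h x
    simp only [hxy, Option.bind_some] at this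
    exact this
  · intro h
    funext x
    rcases hx : α x with _ | y
    · rfl
    · exact h x y hx

/-! ### Corollary 2.7.3, Exercise 2.7.7: idempotents of `ℐ𝒮ₙ` -/

/-- Corollary 2.7.3: a partial injection `α` is an idempotent iff it is the identity
transformation `ε_A` of some subset `A` (namely `A = dom α`), i.e. iff `α x = x` wherever `α` is
defined. [cite: GanyushkinMazorchuk2009, Corollary 2.7.3] -/
theorem idempotent_iff_of_injective {α : X → Option X}
    (hα : ∀ x₁ x₂ y, α x₁ = some y → α x₂ = some y → x₁ = x₂) :
    (fun x => (α x).bind α) = α ↔ ∀ x y, α x = some y → y = x := by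
  rw [idempotent_iff]
  constructor
  · intro h x y hxy
    exact hα y x y (h x y hxy) hxy
  · intro h x y hxy
    obtain rfl := h x y hxy
    exact hxy

/-- Corollary 2.7.3 (count): `ℐ𝒮ₙ` contains exactly `2ⁿ` idempotents, the partial identities
`ε_A`, `A ⊆ {1, …, n}`. [cite: GanyushkinMazorchuk2009, Corollary 2.7.3] -/
theorem card_injective_idempotents [Fintype X] [DecidableEq X] :
    Fintype.card {α : X → Option X // (∀ x₁ x₂ y, α x₁ = some y → α x₂ = some y → x₁ = x₂) ∧
      (fun x => (α x).bind α) = α} = 2 ^ Fintype.card X := by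
  -- idempotent partial injections = partial identities ≃ subsets (recorded as `X → Bool`)
  have key : ∀ α : X → Option X,
      ((∀ x₁ x₂ y, α x₁ = some y → α x₂ = some y → x₁ = x₂) ∧ (fun x => (α x).bind α) = α) ↔
        ∀ x y, α x = some y → y = x := by
    intro α
    constructor
    · rintro ⟨h1, h2⟩
      exact (idempotent_iff_of_injective h1).1 h2
    · intro h
      have h1 : ∀ x₁ x₂ y, α x₁ = some y → α x₂ = some y → x₁ = x₂ :=
        fun x₁ x₂ y e1 e2 => (h x₁ y e1).symm.trans (h x₂ y e2)
      exact ⟨h1, (idempotent_iff_of_injective h1).2 h⟩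
  let e : {α : X → Option X // (∀ x₁ x₂ y, α x₁ = some y → α x₂ = some y → x₁ = x₂) ∧
      (fun x => (α x).bind α) = α} ≃ (X → Bool) :=
    { toFun := fun α x => (α.1 x).isSome
      invFun := fun b => ⟨fun x => if b x then some x else none, (key _).2 fun x y h => by
        by_cases hb : b x
        · simp only [hb, ↓reduceIte, Option.some.injEq] at h
          exact h.symm
        · simp [hb] at h⟩
      left_inv := by
        rintro ⟨α, hα⟩
        apply Subtype.ext
        funext x
        rcases hx : α x with _ | y
        · simp [hx]
        · obtain rfl := (key α).1 hα x y hx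
          simp [hx]
      right_inv := by
        intro b
        funext x
        by_cases hb : b x
        · simp [hb]
        · simp [hb] }
  rw [Fintype.card_congr e, Fintype.card_fun, Fintype.card_bool]

/-- Exercise 2.7.7: `ε_A ε_B = ε_{A ∩ B}` for the partial identities `ε_A(x) = x` (`x ∈ A`),
undefined otherwise. [cite: GanyushkinMazorchuk2009, Exercise 2.7.7] -/
theorem partialId_mul_partialId (A B : Set X) [DecidablePred (· ∈ A)] [DecidablePred (· ∈ B)]
    [DecidablePred (· ∈ A ∩ B)] :
    (fun x => ((fun y => if y ∈ B then some y else none) x).bind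
        (fun y => if y ∈ A then some y else none)) =
      fun x => if x ∈ A ∩ B then some x else none := by
  funext x
  by_cases hB : x ∈ B
  · by_cases hA : x ∈ A
    · simp [hA, hB]
    · simp [hA, hB]
  · have : x ∉ A ∩ B := fun h => hB h.2
    simp [hB, this]

/-! ### Corollary 2.7.5: the number of idempotents of `𝒫𝒯ₙ` -/

/-- The idempotents of `𝒫𝒯(X)` with image a given subset `A` correspond to the arbitrary
partial maps `X ∖ A → A` (on `A` they are the identity), hence there are `(|A| + 1)^{n - |A|}`
of them. [cite: GanyushkinMazorchuk2009, Corollary 2.7.5 (proof)] -/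
theorem card_idempotents_image_eq [Fintype X] [DecidableEq X] (A : Finset X) :
    Fintype.card {α : X → Option X // (fun x => (α x).bind α) = α ∧
      Finset.univ.filter (fun y => ∃ x, α x = some y) = A} =
      (A.card + 1) ^ (Fintype.card X - A.card) := by
  have key : ∀ α : X → Option X, ((fun x => (α x).bind α) = α ∧
      Finset.univ.filter (fun y => ∃ x, α x = some y) = A) ↔
      (∀ x y, α x = some y → y ∈ A) ∧ ∀ y ∈ A, α y = some y := by
    intro α
    rw [idempotent_iff, Finset.ext_iff]
    simp only [Finset.mem_filter, Finset.mem_univ, true_and]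
    constructor
    · rintro ⟨h1, h2⟩
      refine ⟨fun x y hxy => (h2 y).1 ⟨x, hxy⟩, fun y hy => ?_⟩
      obtain ⟨x, hxy⟩ := (h2 y).2 hy
      exact h1 x y hxy
    · rintro ⟨h1, h2⟩
      refine ⟨fun x y hxy => h2 y (h1 x y hxy), fun y => ⟨?_, fun hy => ⟨y, h2 y hy⟩⟩⟩
      rintro ⟨x, hxy⟩
      exact h1 x y hxy
  let e : {α : X → Option X // (fun x => (α x).bind α) = α ∧
      Finset.univ.filter (fun y => ∃ x, α x = some y) = A} ≃ (↥(Aᶜ) → Option ↥A) :=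
    { toFun := fun α x => (α.1 x.1).bind fun y => if hy : y ∈ A then some ⟨y, hy⟩ else none
      invFun := fun g => ⟨fun x => if hx : x ∈ A then some x
          else (g ⟨x, Finset.mem_compl.2 hx⟩).map Subtype.val,
        (key _).2 ⟨fun x y hxy => by
          by_cases hx : x ∈ A
          · rw [dif_pos hx, Option.some_inj] at hxy
            exact hxy ▸ hx
          · rw [dif_neg hx, Option.map_eq_some_iff] at hxy
            obtain ⟨a, -, rfl⟩ := hxy
            exact a.2, fun y hy => by simp [hy]⟩⟩
      left_inv := by
        rintro ⟨α, hα⟩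
        apply Subtype.ext
        funext x
        dsimp only
        by_cases hx : x ∈ A
        · rw [dif_pos hx]
          exact (((key α).1 hα).2 x hx).symm
        · rw [dif_neg hx]
          rcases hαx : α x with _ | y
          · simp
          · have hy : y ∈ A := ((key α).1 hα).1 x y hαx
            simp [hy]
      right_inv := by
        intro g
        funext x
        have hx : (x : X) ∉ A := Finset.mem_compl.1 x.2
        dsimp only
        rw [dif_neg hx]
        rcases hgx : g x with _ | a
        · simp
        · simp [a.2] }
  rw [Fintype.card_congr e, Fintype.card_fun, Fintype.card_option, Fintype.card_coe,
    Fintype.card_coe, Finset.card_compl]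

/-- Corollary 2.7.5: the number `u'ₙ` of idempotents of `𝒫𝒯ₙ` is
`u'ₙ = ∑_{k=0}^{n} (n choose k) (k + 1)^{n-k}` — choose the `k`-element image, then a partial
map from its complement into it. [cite: GanyushkinMazorchuk2009, Corollary 2.7.5] -/
theorem card_idempotents [Fintype X] [DecidableEq X] :
    Fintype.card {α : X → Option X // (fun x => (α x).bind α) = α} =
      ∑ k ∈ Finset.range (Fintype.card X + 1),
        (Fintype.card X).choose k * (k + 1) ^ (Fintype.card X - k) := by
  have h1 : Fintype.card {α : X → Option X // (fun x => (α x).bind α) = α} =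
      ∑ A : Finset X, Fintype.card {α : X → Option X // (fun x => (α x).bind α) = α ∧
        Finset.univ.filter (fun y => ∃ x, α x = some y) = A} := by
    rw [Fintype.card_subtype]
    rw [Finset.card_eq_sum_card_fiberwise
      (f := fun α : X → Option X => Finset.univ.filter (fun y => ∃ x, α x = some y))
      (t := Finset.univ) (fun _ _ => Finset.mem_coe.2 (Finset.mem_univ _))]
    refine Finset.sum_congr rfl fun A _ => ?_
    rw [Fintype.card_subtype, Finset.filter_filter]
  rw [h1]
  simp_rw [card_idempotents_image_eq]
  have h2 := Finset.sum_powerset_apply_card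
    (fun k => (k + 1) ^ (Fintype.card X - k)) (x := (Finset.univ : Finset X))
  simp only [Finset.powerset_univ, Finset.card_univ, smul_eq_mul] at h2
  rw [h2]

end Literature.Algebra.Semigroups.PartialTransformation
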